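import Mathlib.NumberTheory.Zsqrtd.GaussianInt
import Mathlib.Data.Finset.Card
import Mathlib.Data.Fintype.Fin
import Mathlib.Algebra.Order.Group.Abs
import Mathlib.Tactic
import HarnessLib

/-!
# Venture HSemireg — PAD-4, balanced lattice alphabet 𝔅: no finite two-level design has its charged core doubly served on three factors (THEOREM DS⁻)

Cell `pub-hsemireg`, seat `hodge-bloch-bc5-plan` g3 (№3 bc5-witness planner of `route-HodgeConjecture-EightfoldBlochSeeds`);
note of record `hodge-bloch-bc5-plan/BC5-PLAN-g3-MEMO.md` v1.0 §1–§2 (LEMMAS NC ∕ MON ∕ X, THEOREM DS⁻), which answers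
PROBLEM DS of `s4push/search-1/PAD4-BALANCED-search-1.md` (v0.1 §3 (O1); v0.3 §7) in its closed form.

SETTING (the abstract encoding). A finite set `D` of constituents `Z : ι`, each with a colour `isN Z` (`true` = lower
level `E₋`, `false` = upper level `E₊`) and, per factor `f : Fin 4`, a balanced class `x Z f = (α, β) ∈ ℤ × ℤ[i]`
(the block `[[α, β], [β̄, α]]`). `Z` is CHARGED on `f` when `β ≠ 0`. A demand-side rank-one partner («leg») of `Z`
along `f` is a constituent `W` of the opposite colour that agrees with `Z` off `f` and differs on `f` by a null vector
`Δ = (d, Δβ)` with `d > 0` and `N(Δβ) = d²`, taken downwards from an `N` and upwards from a `P`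
(`legDiff`, `IsLeg`). Two legs along `f` have DISTINCT DIRECTIONS when `Δ₁` and `Δ₂` are not proportional
(`d₁ Δβ₂ ≠ d₂ Δβ₁`); `Z` is doubly served along `f` when it has two legs along `f` with distinct directions.

CONTENT.
* `lam`, `lam_lt_of_leg_neg`, `lam_lt_of_leg_pos` — LEMMA MON for the balanced potential
  `λ(Z) = α₀ + α₁ − α₂ − α₃`: a demand-side partner of an `N` along a factor of `{2, 3}`, or of a `P` along a factor
  of `{0, 1}`, has strictly larger `λ`.
* `no_closed_triply_served` — LEMMA X: no finite non-empty population `T` in which every member has, along each of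
  `≥ 3` factors, a demand-side partner inside `T` (pure order argument on the `α`-coordinates: the `λ`-maximum of `T`
  is contradicted, since any three factors meet both `{0, 1}` and `{2, 3}`).
* `charged_or_charged_of_distinctDir` — LEMMA NC: of two legs of `Z` along `f` with distinct directions at least one
  lands charged on `f` (both uncharged forces `Δβ₁ = Δβ₂`, then `d₁ = d₂`).
* `no_core_doubly_served_thrice` — THEOREM DS⁻: for every threshold `m`, if some constituent is charged on `≥ m`
  factors, it is impossible that every constituent charged on `≥ m` factors is doubly served (inside `D`) along `≥ 3`
  factors (`m = 4`: the fully charged core; `m = 3, 2`: the corollaries of the memo).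

HONEST FRAMING: finite order-theoretic combinatorics on classes and incidences of two-level ⊕-block designs (a
necessary-condition calculus of the cell's PAD-4 notes). Nothing in this file is a statement about a variety, a sheaf
or a Hodge class, and nothing here bears on HC / HC_CM / HC_AV.
-/

namespace Summit.Ventures.HSemireg.Pad4NoClosedTripleService

open Finset

variable {ι : Type*}

/-! ## The order core (LEMMAS MON and X) -/

/-- `W` serves `Z` along `f` on the demand side (trace coordinates only): opposite colour, equal `α` off `f`, and
`α_f` strictly smaller when `Z` is an `N` (partner below), strictly larger when `Z` is a `P` (partner above). -/
def Serves (isN : ι → Bool) (α : ι → Fin 4 → ℤ) (Z W : ι) (f : Fin 4) : Prop :=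
  isN W ≠ isN Z ∧ (∀ g, g ≠ f → α W g = α Z g) ∧
    (if isN Z = true then α W f < α Z f else α Z f < α W f)

/-- The balanced potential `λ_s`, `s = (+,+,−,−)`. -/
def lam (α : ι → Fin 4 → ℤ) (Z : ι) : ℤ := α Z 0 + α Z 1 - α Z 2 - α Z 3

/-- **LEMMA MON, lower side.** A demand-side partner of an `N` along a factor of `{2, 3}` has larger `λ`. -/
theorem lam_lt_of_leg_neg (isN : ι → Bool) (α : ι → Fin 4 → ℤ) {Z W : ι} {f : Fin 4} (hZ : isN Z = true)
    (hs : Serves isN α Z W f) (hf : f = 2 ∨ f = 3) : lam α Z < lam α W := by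
  obtain ⟨-, hoff, hon⟩ := hs
  rw [if_pos hZ] at hon
  unfold lam
  rcases hf with rfl | rfl
  · have h0 := hoff 0 (by decide); have h1 := hoff 1 (by decide); have h3 := hoff 3 (by decide)
    omega
  · have h0 := hoff 0 (by decide); have h1 := hoff 1 (by decide); have h2 := hoff 2 (by decide)
    omega

/-- **LEMMA MON, upper side.** A demand-side partner of a `P` along a factor of `{0, 1}` has larger `λ`. -/
theorem lam_lt_of_leg_pos (isN : ι → Bool) (α : ι → Fin 4 → ℤ) {Z W : ι} {f : Fin 4} (hZ : isN Z = false)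
    (hs : Serves isN α Z W f) (hf : f = 0 ∨ f = 1) : lam α Z < lam α W := by
  obtain ⟨-, hoff, hon⟩ := hs
  rw [if_neg (by simp [hZ])] at hon
  unfold lam
  rcases hf with rfl | rfl
  · have h1 := hoff 1 (by decide); have h2 := hoff 2 (by decide); have h3 := hoff 3 (by decide)
    omega
  · have h0 := hoff 0 (by decide); have h2 := hoff 2 (by decide); have h3 := hoff 3 (by decide)
    omega

/-- Any set of at least three of the four factors meets `{2, 3}` and meets `{0, 1}`. -/
theorem exists_neg_and_pos_of_three_le_card (F : Finset (Fin 4)) (hF : 3 ≤ F.card) :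
    (∃ f ∈ F, f = 2 ∨ f = 3) ∧ (∃ f ∈ F, f = 0 ∨ f = 1) := by
  constructor
  · by_contra h
    push Not at h
    have hsub : F ⊆ ({0, 1} : Finset (Fin 4)) := by
      intro f hf
      have := h f hf
      fin_cases f <;> simp_all
    have := card_le_card hsub
    simp at this
    omega
  · by_contra h
    push Not at h
    have hsub : F ⊆ ({2, 3} : Finset (Fin 4)) := by
      intro f hf
      have := h f hf
      fin_cases f <;> simp_all
    have := card_le_card hsub
    simp at this
    omega

/-- **LEMMA X (no finite closed triply-served population).** There is no finite non-empty population `T` of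
constituents such that every member of `T` has, along each of at least three factors, a demand-side partner
(opposite colour, equal trace coordinates off the factor, strictly lower ∕ higher on it) inside `T`. -/
theorem no_closed_triply_served (isN : ι → Bool) (α : ι → Fin 4 → ℤ) (T : Finset ι) (hT : T.Nonempty)
    (h : ∀ Z ∈ T, ∃ F : Finset (Fin 4), 3 ≤ F.card ∧ ∀ f ∈ F, ∃ W ∈ T, Serves isN α Z W f) : False := by
  obtain ⟨Z, hZT, hmax⟩ := exists_max_image T (lam α) hT
  obtain ⟨F, hF, hserv⟩ := h Z hZT
  obtain ⟨⟨f, hfF, hf⟩, ⟨g, hgF, hg⟩⟩ := exists_neg_and_pos_of_three_le_card F hF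
  cases hc : isN Z
  · obtain ⟨W, hWT, hW⟩ := hserv g hgF
    have := lam_lt_of_leg_pos isN α hc hW hg
    exact absurd (hmax W hWT) (not_le.mpr this)
  · obtain ⟨W, hWT, hW⟩ := hserv f hfF
    have := lam_lt_of_leg_neg isN α hc hW hf
    exact absurd (hmax W hWT) (not_le.mpr this)

/-! ## Balanced classes `ℤ × ℤ[i]`, legs, directions (LEMMA NC and THEOREM DS⁻) -/

/-- The demand-side class difference on factor `f`: `x Z f − x W f` for an `N` (partner below), `x W f − x Z f` for
a `P` (partner above). -/
def legDiff (isN : ι → Bool) (x : ι → Fin 4 → ℤ × GaussianInt) (Z W : ι) (f : Fin 4) : ℤ × GaussianInt :=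
  if isN Z = true then x Z f - x W f else x W f - x Z f

/-- `W` is a demand-side rank-one partner (LEG) of `Z` along `f`: opposite colour, equal classes off `f`, and on `f`
a null difference `(d, Δβ)` with `d > 0` and `N(Δβ) = d²`. -/
def IsLeg (isN : ι → Bool) (x : ι → Fin 4 → ℤ × GaussianInt) (Z W : ι) (f : Fin 4) : Prop :=
  isN W ≠ isN Z ∧ (∀ g, g ≠ f → x W g = x Z g) ∧ 0 < (legDiff isN x Z W f).1 ∧
    Zsqrtd.norm (legDiff isN x Z W f).2 = (legDiff isN x Z W f).1 ^ 2

/-- Two legs of `Z` along `f` have DISTINCT DIRECTIONS: their null differences are not proportional. -/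
def DistinctDir (isN : ι → Bool) (x : ι → Fin 4 → ℤ × GaussianInt) (Z W₁ W₂ : ι) (f : Fin 4) : Prop :=
  ((legDiff isN x Z W₁ f).1 : GaussianInt) * (legDiff isN x Z W₂ f).2 ≠
    ((legDiff isN x Z W₂ f).1 : GaussianInt) * (legDiff isN x Z W₁ f).2

/-- **LEMMA NC (non-cancellation).** Of two legs of `Z` along `f` with distinct directions, at least one partner is
charged on `f`. -/
theorem charged_or_charged_of_distinctDir (isN : ι → Bool) (x : ι → Fin 4 → ℤ × GaussianInt) {Z W₁ W₂ : ι}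
    {f : Fin 4} (h₁ : IsLeg isN x Z W₁ f) (h₂ : IsLeg isN x Z W₂ f) (hd : DistinctDir isN x Z W₁ W₂ f) :
    (x W₁ f).2 ≠ 0 ∨ (x W₂ f).2 ≠ 0 := by
  by_contra hc
  push Not at hc
  obtain ⟨hW₁, hW₂⟩ := hc
  obtain ⟨-, -, hpos₁, hnorm₁⟩ := h₁
  obtain ⟨-, -, hpos₂, hnorm₂⟩ := h₂
  -- the two null differences have the same `β`-part
  have hβ : (legDiff isN x Z W₁ f).2 = (legDiff isN x Z W₂ f).2 := by
    unfold legDiff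
    cases isN Z <;> simp [hW₁, hW₂]
  -- hence the same length
  have hsq : (legDiff isN x Z W₁ f).1 ^ 2 = (legDiff isN x Z W₂ f).1 ^ 2 := by
    rw [← hnorm₁, ← hnorm₂, hβ]
  have hd₁ : (legDiff isN x Z W₁ f).1 = (legDiff isN x Z W₂ f).1 := by
    have habs := (sq_eq_sq_iff_abs_eq_abs _ _).mp hsq
    rwa [abs_of_pos hpos₁, abs_of_pos hpos₂] at habs
  apply hd
  rw [hd₁, hβ]

/-- A leg along `f` does not change the charges off `f`. -/
theorem charged_iff_of_leg (isN : ι → Bool) (x : ι → Fin 4 → ℤ × GaussianInt) {Z W : ι} {f g : Fin 4}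
    (h : IsLeg isN x Z W f) (hg : g ≠ f) : (x W g).2 ≠ 0 ↔ (x Z g).2 ≠ 0 := by
  rw [h.2.1 g hg]

/-- The set of charged factors of `Z`. -/
noncomputable def chargedSet (x : ι → Fin 4 → ℤ × GaussianInt) (Z : ι) : Finset (Fin 4) := by
  classical exact univ.filter fun f => (x Z f).2 ≠ 0

/-- Membership in the charged set. -/
theorem mem_chargedSet (x : ι → Fin 4 → ℤ × GaussianInt) (Z : ι) (f : Fin 4) :
    f ∈ chargedSet x Z ↔ (x Z f).2 ≠ 0 := by
  classical
  unfold chargedSet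
  simp

/-- A leg of `Z` along `f` whose partner is charged on `f` keeps (or enlarges) the charged set. -/
theorem chargedSet_subset_of_leg (isN : ι → Bool) (x : ι → Fin 4 → ℤ × GaussianInt) {Z W : ι} {f : Fin 4}
    (h : IsLeg isN x Z W f) (hW : (x W f).2 ≠ 0) : chargedSet x Z ⊆ chargedSet x W := by
  intro g hg
  rw [mem_chargedSet] at hg ⊢
  by_cases hgf : g = f
  · subst hgf; exact hW
  · exact (charged_iff_of_leg isN x h hgf).mpr hg

/-- A leg is a demand-side partner for the trace coordinates. -/
theorem serves_of_leg (isN : ι → Bool) (x : ι → Fin 4 → ℤ × GaussianInt) {Z W : ι} {f : Fin 4}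
    (h : IsLeg isN x Z W f) : Serves isN (fun Y g => (x Y g).1) Z W f := by
  obtain ⟨hcol, hoff, hpos, -⟩ := h
  refine ⟨hcol, fun g hg => by simp only [hoff g hg], ?_⟩
  unfold legDiff at hpos
  cases hZ : isN Z
  · rw [hZ] at hpos
    simp at hpos ⊢
    omega
  · rw [hZ] at hpos
    simp at hpos ⊢
    omega

/-- **THEOREM DS⁻.** In a finite two-level design over the balanced alphabet (any support, phases, multiplicities,
layers) fix a threshold `m`. If some constituent is charged on at least `m` factors, it is impossible that every
constituent charged on at least `m` factors is doubly served — two legs with distinct directions, partners in the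
design — along at least three factors. (`m = 4`: the fully charged core, which hypothesis (H1) makes non-empty.) -/
theorem no_core_doubly_served_thrice (D : Finset ι) (isN : ι → Bool) (x : ι → Fin 4 → ℤ × GaussianInt) (m : ℕ)
    (hne : ∃ Z ∈ D, m ≤ (chargedSet x Z).card)
    (h : ∀ Z ∈ D, m ≤ (chargedSet x Z).card → ∃ F : Finset (Fin 4), 3 ≤ F.card ∧ ∀ f ∈ F,
      ∃ W₁ ∈ D, ∃ W₂ ∈ D, IsLeg isN x Z W₁ f ∧ IsLeg isN x Z W₂ f ∧ DistinctDir isN x Z W₁ W₂ f) :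
    False := by
  classical
  set T : Finset ι := D.filter fun Z => m ≤ (chargedSet x Z).card with hTdef
  have hT : T.Nonempty := by
    obtain ⟨Z, hZD, hZ⟩ := hne
    exact ⟨Z, by rw [hTdef, mem_filter]; exact ⟨hZD, hZ⟩⟩
  refine no_closed_triply_served isN (fun Y g => (x Y g).1) T hT ?_
  intro Z hZT
  rw [hTdef, mem_filter] at hZT
  obtain ⟨hZD, hZm⟩ := hZT
  obtain ⟨F, hF, hserv⟩ := h Z hZD hZm
  refine ⟨F, hF, fun f hf => ?_⟩
  obtain ⟨W₁, hW₁D, W₂, hW₂D, hL₁, hL₂, hdir⟩ := hserv f hf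
  -- the non-cancelling partner stays in the population
  rcases charged_or_charged_of_distinctDir isN x hL₁ hL₂ hdir with hc | hc
  · refine ⟨W₁, ?_, serves_of_leg isN x hL₁⟩
    rw [mem_filter]
    exact ⟨hW₁D, hZm.trans (card_le_card (chargedSet_subset_of_leg isN x hL₁ hc))⟩
  · refine ⟨W₂, ?_, serves_of_leg isN x hL₂⟩
    rw [mem_filter]
    exact ⟨hW₂D, hZm.trans (card_le_card (chargedSet_subset_of_leg isN x hL₂ hc))⟩

end Summit.Ventures.HSemireg.Pad4NoClosedTripleService
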